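import Summits.QuantumFields.QCD.Theorems.HeatSlicedQuarksQuarkLoopCoefficient

/-!
# Line `NearConstantFlux` — forward rung over the PROVED floor `QuarkLoopCoefficient`
# (crux dir of stmt-QuantumFields-18031 `HeatSlicedQuarks.InterleavedFlowProper`; forward generator G1, seed g1-QuantumFields-16786)

FLOOR (proved, 329 lines + 50 aux files): `Summit.QuantumFields.QCD.Cruxes.QuarkLoopCoefficient.Sketch.QuarkLoopCoefficient_of :
HeatSlicedQuarks.QuarkLoopCoefficient` — for Cartan-diagonal `SU(3)` fields on `T_L` with CONSTANT `(0,1)` plaquette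
`diag(e^{iθ}, e^{−iθ}, 1)` and all other plaquettes trivial, the colour–spin traced on-diagonal correction
`Δ_U(t,x) = Σ_{aα} Re[e^{−tH_U} − e^{−tH_1}]((x,a,α),(x,a,α))` (`H = D_Wᴴ D_W`, massless, `r = 1`) equals
`(1 − cos θ)/(3π²)` up to `Cθ²(1/t + θ²t²) + Ce^{−cL²/(t+L)}/t²` on `1 ≤ t ≤ L²`, `t|θ| ≤ 1`.

RUNG (this file, `QuarkLoopNearConstantFlux 1`): the SAME reading for NEAR-CONSTANT flux — ONE hypothesis generalised:
the `(0,1)` plaquette at `y` is `diag(e^{i(θ+η y)}, e^{−i(θ+η y)}, 1)` with a deviation field `|η y| ≤ δ`; the conclusion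
reads the LOCAL coefficient `(1 − cos(θ + η x))/(3π²)` with error `C(θ²+δ²)(1/t + (θ²+δ²)t²) + C(|θ|+δ)δt + tail` on
`t(|θ|+δ) ≤ 1`.  Graded family `QuarkLoopNearConstantFlux δ₀` (deviation `δ ≤ δ₀`): member `0` is LITERALLY the floor
(witness `Lines/NearConstantFlux_special.lean`, `example : QuarkLoopNearConstantFlux 0` from the floor decl, rc 0, no
sorry); member `1` is the rung (and equals every member `δ₀ ≥ 1`, since `t ≥ 1`, `t(|θ|+δ) ≤ 1` force `δ ≤ 1`).

WHY THE FLOOR'S PROOF STOPS: `stub_torusToPlane` (`…QuarkLoopCoefficientTorusToPlane.lean:155`) classifies the field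
as gauge-equivalent to the symmetric-gauge `symLink θ` (`exists_gauge_symLink`, `…TorusToPlaneAuxB.lean`) and uses
magnetic-translation covariance (`heatKer_symLink`, `…TorusToPlaneAux.lean`) to reduce everything to the SYMBOL
`symHeat θ t`; a non-constant flux has no symbol, no twisted-convolution calculus (`vtx`, `pert0/1`, `e2`) and no
`secondOrderExpansion`.  What survives by name: colour decoupling + deck periodization (`hasSum_heatKer_deck`,
`…TorusToPlaneAuxC–E`), the free toolkit, `stub_windowBound`'s SFU input (closed crux 8871), Davies–Gaffney (8873).

THE LINE (two registered stubs, composition kernel-checked, the floor used BY NAME inside `QuarkLoopNearConstantFlux_of`):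
  rung  =  floor at the quantised mean flux `θ̄ = 2πn/L²` (`stub_comparisonFlux`: flux quantisation on a torus
           2-plane + the explicit constant-flux Cartan configuration)  ⊕  a FROZEN-FLUX COMPARISON
           (`stub_frozenComparison`: `|Δ_U − Δ_{U_c}| ≤ C(|θ|+δ)δt + C(θ²+δ²)²t² + tail` — exact Duhamel
           `e^{−tH_U} − e^{−tH_{U_c}} = −∫₀ᵗ e^{−(t−s)H_U}(H_U − H_{U_c})e^{−sH_{U_c}} ds` in an `x`-centred axial
           gauge where `|U − U_c|(e) ≤ Cδ·dist(e,x)`, the first order in the deviation killed by charge conjugation at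
           `θ̄ = 0` and re-expressed as `∫₀^{θ̄} ∂_θ` (mixed second order), every insertion costed by two-regime
           Gaussian majorants WITH the `(1+t)⁻²` prefactor; the window `c₀ < t(|θ|+δ)` crude by SFU monotonicity as
           in the floor — hence the Landau-type escape term `C(θ²+δ²)²t²`).
Hardest stub: `stub_frozenComparison` (its hardest sub-lemma, NOT registered because the composition does not consume
it directly: the pointwise Gaussian majorant with `(1+t)⁻²` prefactor for the `ℤ⁴` kernel `heatKer u t` of a ROUGH
small abelian field, `t·sup|plaquette angle| ≤ c₀` — Davies' exponential-weight perturbation of the SFU fixed point, or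
Coulhon–Sikora "on-diagonal + Davies–Gaffney ⇒ Gaussian" which needs no positivity).
-/

noncomputable section

namespace Summit.QuantumFields.QCD.Cruxes.InterleavedFlowProper.NearConstantFlux

open Literature.MathematicalPhysics.QuantumLattice Literature.MathematicalPhysics.QuantumFieldTheory
open Literature.Probability.LatticeModels (Site TorusSite)
open Summit.QuantumFields.QCD.Theses.HeatSlicedQuarks

/-! ## §1 The rung family -/

/-- **Rung family** (forward generator G1 over the floor `QuarkLoopCoefficient`): the quark-loop coefficient read off
the lattice heat kernel for NEAR-CONSTANT abelian flux.  Hypotheses as in the floor (Cartan-diagonal `SU(3)` links on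
`T_L`, all plaquettes outside the `(0,1)` plane trivial) except that the `(0,1)` plaquette at `y` is
`diag(e^{i(θ + η y)}, e^{−i(θ + η y)}, 1)` with a deviation field `|η y| ≤ δ ≤ δ₀` (the floor is `δ₀ = 0`, i.e. `η ≡ 0`).
Conclusion: the colour–spin traced on-diagonal correction of the massless Wilson heat kernel at `x` equals the LOCAL
continuum coefficient `(1 − cos(θ + η x))/(3π²)` up to the floor's error with `θ² ↦ θ² + δ²`, a deviation term
`C (|θ| + δ) δ t`, and the floor's Davies–Gaffney finite-volume tail, uniformly on `1 ≤ t ≤ L²`, `t (|θ| + δ) ≤ 1`. -/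
def QuarkLoopNearConstantFlux (δ₀ : ℝ) : Prop :=
  ∃ C c : ℝ, 0 < c ∧ ∀ (δ : ℝ), 0 ≤ δ → δ ≤ δ₀ → ∀ (L : ℕ) [NeZero L] (U : Literature.MathematicalPhysics.QuantumFieldTheory.GaugeConfig 4 L (Matrix.specialUnitaryGroup (Fin 3) ℂ)) (θ : ℝ) (η : Literature.Probability.LatticeModels.TorusSite 4 L → ℝ), (∀ y : Literature.Probability.LatticeModels.TorusSite 4 L, |η y| ≤ δ) → (∀ (e : Literature.MathematicalPhysics.QuantumFieldTheory.Edge 4 L) (i j : Fin 3), i ≠ j → (Literature.MathematicalPhysics.QuantumLattice.fundamentalRep (Fin 3)) (U e) i j = 0) → (∀ y : Literature.Probability.LatticeModels.TorusSite 4 L, (Literature.MathematicalPhysics.QuantumLattice.fundamentalRep (Fin 3)) (Literature.MathematicalPhysics.QuantumFieldTheory.plaquetteHolonomy U y 0 1) = Matrix.diagonal ![Complex.exp (Complex.I * (θ + η y)), Complex.exp (-(Complex.I * (θ + η y))), 1]) → (∀ (y : Literature.Probability.LatticeModels.TorusSite 4 L) (μ ν : Fin 4), ¬(μ = 0 ∧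 ν = 1) → ¬(μ = 1 ∧ ν = 0) → Literature.MathematicalPhysics.QuantumFieldTheory.plaquetteHolonomy U y μ ν = 1) → ∀ (t : ℝ), 1 ≤ t → t ≤ (L : ℝ) ^ 2 → t * (|θ| + δ) ≤ 1 → ∀ (x : Literature.Probability.LatticeModels.TorusSite 4 L), |(∑ a : Fin 3, ∑ α : Fin 4, ((NormedSpace.exp (-(t : ℂ) • (Matrix.conjTranspose (Literature.MathematicalPhysics.QuantumLattice.wilsonDirac (Literature.MathematicalPhysics.QuantumLattice.fundamentalRep (Fin 3)) U 0 1) * Literature.MathematicalPhysics.QuantumLattice.wilsonDirac (Literature.MathematicalPhysics.QuantumLattice.fundamentalRep (Fin 3)) U 0 1))) (x, a, α) (x, a, α)).re) - (∑ a : Fin 3, ∑ α : Fin 4, ((NormedSpace.exp (-(t : ℂ) • (Matrix.conjTranspose (Literature.MathematicalPhysics.QuantumLattice.wilsonDirac (Literature.MathematicalPhysics.QuantumLattice.fundamentalRep (Fin 3)) (fun _ : Literature.MathematicalPhysics.QuantumFieldTheory.Edge 4 L => (1 : Matrix.specialUnitaryGroup (Fin 3) ℂ)) 0 1) * Literature.MathematicalPhysics.QuantumLattice.wilsonDirac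 (Literature.MathematicalPhysics.QuantumLattice.fundamentalRep (Fin 3)) (fun _ : Literature.MathematicalPhysics.QuantumFieldTheory.Edge 4 L => (1 : Matrix.specialUnitaryGroup (Fin 3) ℂ)) 0 1))) (x, a, α) (x, a, α)).re) - (1 - Real.cos (θ + η x)) / (3 * Real.pi ^ 2)| ≤ C * (θ ^ 2 + δ ^ 2) * (1 / t + (θ ^ 2 + δ ^ 2) * t ^ 2) + C * (|θ| + δ) * δ * t + C * Real.exp (-(c * (L : ℝ) ^ 2 / (t + (L : ℝ)))) / t ^ 2

/-! ## §2 The two stub statements -/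

/-- Stub statement 1 (lattice gauge geometry, size M): **the quantised comparison flux exists.**  For a Cartan-diagonal
field whose `(0,1)` plaquettes are `diag(e^{i(θ+η y)}, e^{−i(θ+η y)}, 1)` with `|η| ≤ δ` (other planes trivial), flux
quantisation over one `(0,1)` torus 2-plane (the product of the abelian plaquette phases over a closed 2-torus telescopes
to `1`) gives `L²θ + Σ_plane η ∈ 2πℤ`, hence a quantised `θ̄ = 2πn/L²` with `|θ̄ − θ| ≤ δ`; and for every `θ̄ ∈ (2π/L²)ℤ`
the Landau-gauge-with-twist links `u(y,1) = e^{iθ̄ ŷ₀}`, `u(y,0) = e^{−iθ̄ L ŷ₁·[ŷ₀ = L−1]}` embedded as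
`diag(u, ū, 1) ∈ SU(3)` realise the CONSTANT plaquette `diag(e^{iθ̄}, e^{−iθ̄}, 1)` with all other plaquettes trivial. -/
def ComparisonFlux : Prop :=
  ∀ (L : ℕ) [NeZero L] (U : Literature.MathematicalPhysics.QuantumFieldTheory.GaugeConfig 4 L (Matrix.specialUnitaryGroup (Fin 3) ℂ)) (θ δ : ℝ) (η : Literature.Probability.LatticeModels.TorusSite 4 L → ℝ), 0 ≤ δ → (∀ y : Literature.Probability.LatticeModels.TorusSite 4 L, |η y| ≤ δ) → (∀ (e : Literature.MathematicalPhysics.QuantumFieldTheory.Edge 4 L) (i j : Fin 3), i ≠ j → (Literature.MathematicalPhysics.QuantumLattice.fundamentalRep (Fin 3)) (U e) i j = 0) → (∀ y : Literature.Probability.LatticeModels.TorusSite 4 L, (Literature.MathematicalPhysics.QuantumLattice.fundamentalRep (Fin 3)) (Literature.MathematicalPhysics.QuantumFieldTheory.plaquetteHolonomy U y 0 1) = Matrix.diagonal ![Complex.exp (Complex.I * (θ + η y)), Complex.exp (-(Complex.I * (θ + η y))), 1]) → (∀ (y : Literature.Probability.LatticeModels.TorusSite 4 L) (μ ν : Fin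 4), ¬(μ = 0 ∧ ν = 1) → ¬(μ = 1 ∧ ν = 0) → Literature.MathematicalPhysics.QuantumFieldTheory.plaquetteHolonomy U y μ ν = 1) → ∃ (Uc : Literature.MathematicalPhysics.QuantumFieldTheory.GaugeConfig 4 L (Matrix.specialUnitaryGroup (Fin 3) ℂ)) (θb : ℝ), (∀ (e : Literature.MathematicalPhysics.QuantumFieldTheory.Edge 4 L) (i j : Fin 3), i ≠ j → (Literature.MathematicalPhysics.QuantumLattice.fundamentalRep (Fin 3)) (Uc e) i j = 0) ∧ (∀ y : Literature.Probability.LatticeModels.TorusSite 4 L, (Literature.MathematicalPhysics.QuantumLattice.fundamentalRep (Fin 3)) (Literature.MathematicalPhysics.QuantumFieldTheory.plaquetteHolonomy Uc y 0 1) = Matrix.diagonal ![Complex.exp (Complex.I * θb), Complex.exp (-(Complex.I * θb)), 1]) ∧ (∀ (y : Literature.Probability.LatticeModels.TorusSite 4 L) (μ ν : Fin 4), ¬(μ = 0 ∧ ν = 1) → ¬(μ = 1 ∧ ν = 0) → Literature.MathematicalPhysics.QuantumFieldTheory.plaquetteHolonomy Uc y μ ν = 1) ∧ |θb - θ| ≤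 δ

/-- Stub statement 2 (analysis, size L — the load-bearing stub): **frozen-flux comparison.**  For a near-constant field `U`
(data `θ, η, δ` as in the rung) and a constant-flux Cartan field `U_c` of plaquette angle `θ̄` with `|θ̄ − θ| ≤ δ` on the
same torus (Polyakov phases of both arbitrary — they enter only the tail), the colour–spin traced on-diagonal heat
kernels agree up to `C(|θ|+δ)δt` (mixed second order: deviation × field, deviation²; the first order in the deviation
vanishes at `θ̄ = 0` by charge conjugation), a Landau-type escape `C(θ²+δ²)²t²` (lets the window `c₀ < t(|θ|+δ) ≤ 1`
be done crudely by the SFU bound `≤ C/t²` and diagonal monotonicity, exactly as the floor's `stub_windowBound`), and the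
Davies–Gaffney image tail `Ce^{−cL²/(t+L)}/t²`, on `1 ≤ t ≤ L²`, `t(|θ|+δ) ≤ 1`. -/
def FrozenComparison : Prop :=
  ∃ C c : ℝ, 0 < c ∧ ∀ (L : ℕ) [NeZero L] (U Uc : Literature.MathematicalPhysics.QuantumFieldTheory.GaugeConfig 4 L (Matrix.specialUnitaryGroup (Fin 3) ℂ)) (θ θb δ : ℝ) (η : Literature.Probability.LatticeModels.TorusSite 4 L → ℝ), 0 ≤ δ → (∀ y : Literature.Probability.LatticeModels.TorusSite 4 L, |η y| ≤ δ) → |θb - θ| ≤ δ → (∀ (e : Literature.MathematicalPhysics.QuantumFieldTheory.Edge 4 L) (i j : Fin 3), i ≠ j → (Literature.MathematicalPhysics.QuantumLattice.fundamentalRep (Fin 3)) (U e) i j = 0) → (∀ y : Literature.Probability.LatticeModels.TorusSite 4 L, (Literature.MathematicalPhysics.QuantumLattice.fundamentalRep (Fin 3)) (Literature.MathematicalPhysics.QuantumFieldTheory.plaquetteHolonomy U y 0 1) = Matrix.diagonal ![Complex.exp (Complex.I * (θ + η y)), Complex.exp (-(Complex.I * (θ + η y))), 1]) → (∀ (y :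 Literature.Probability.LatticeModels.TorusSite 4 L) (μ ν : Fin 4), ¬(μ = 0 ∧ ν = 1) → ¬(μ = 1 ∧ ν = 0) → Literature.MathematicalPhysics.QuantumFieldTheory.plaquetteHolonomy U y μ ν = 1) → (∀ (e : Literature.MathematicalPhysics.QuantumFieldTheory.Edge 4 L) (i j : Fin 3), i ≠ j → (Literature.MathematicalPhysics.QuantumLattice.fundamentalRep (Fin 3)) (Uc e) i j = 0) → (∀ y : Literature.Probability.LatticeModels.TorusSite 4 L, (Literature.MathematicalPhysics.QuantumLattice.fundamentalRep (Fin 3)) (Literature.MathematicalPhysics.QuantumFieldTheory.plaquetteHolonomy Uc y 0 1) = Matrix.diagonal ![Complex.exp (Complex.I * θb), Complex.exp (-(Complex.I * θb)), 1]) → (∀ (y : Literature.Probability.LatticeModels.TorusSite 4 L) (μ ν : Fin 4), ¬(μ = 0 ∧ ν = 1) → ¬(μ = 1 ∧ ν = 0) → Literature.MathematicalPhysics.QuantumFieldTheory.plaquetteHolonomy Uc y μ ν = 1) → ∀ (t : ℝ), 1 ≤ t → t ≤ (L : ℝ) ^ 2 → t * (|θ| + δ) ≤ 1 → ∀ (x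 : Literature.Probability.LatticeModels.TorusSite 4 L), |(∑ a : Fin 3, ∑ α : Fin 4, ((NormedSpace.exp (-(t : ℂ) • (Matrix.conjTranspose (Literature.MathematicalPhysics.QuantumLattice.wilsonDirac (Literature.MathematicalPhysics.QuantumLattice.fundamentalRep (Fin 3)) U 0 1) * Literature.MathematicalPhysics.QuantumLattice.wilsonDirac (Literature.MathematicalPhysics.QuantumLattice.fundamentalRep (Fin 3)) U 0 1))) (x, a, α) (x, a, α)).re) - (∑ a : Fin 3, ∑ α : Fin 4, ((NormedSpace.exp (-(t : ℂ) • (Matrix.conjTranspose (Literature.MathematicalPhysics.QuantumLattice.wilsonDirac (Literature.MathematicalPhysics.QuantumLattice.fundamentalRep (Fin 3)) Uc 0 1) * Literature.MathematicalPhysics.QuantumLattice.wilsonDirac (Literature.MathematicalPhysics.QuantumLattice.fundamentalRep (Fin 3)) Uc 0 1))) (x, a, α) (x, a, α)).re)| ≤ C * (|θ| + δ) * δ * t + C * (θ ^ 2 + δ ^ 2) ^ 2 * t ^ 2 + C * Real.exp (-(c * (L : ℝ) ^ 2 / (t + (L : ℝ)))) / t ^ 2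

/-! ## §3 Registered stubs (the ONLY sorries of the file) -/

/-- `stub_comparisonFlux` — flux quantisation + explicit constant-flux Cartan configuration (M). -/
theorem stub_comparisonFlux : ComparisonFlux := by
  sorry

/-- `stub_frozenComparison` — the frozen-flux Duhamel comparison (L; load-bearing). -/
theorem stub_frozenComparison : FrozenComparison := by
  sorry

/-! ## §4 Composition (kernel-checked, no sorry): the floor BY NAME + the two stubs ⟹ the rung -/

/-- `|cos a − cos b| ≤ |a + b|·|a − b|/2` (product-to-sum and `|sin u| ≤ |u|`). -/
theorem abs_cos_sub_cos_le_mul (a b : ℝ) : |Real.cos a - Real.cos b| ≤ |a + b| * |a - b| / 2 := by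
  rw [Real.cos_sub_cos]
  have h1 : |Real.sin ((a + b) / 2)| ≤ |(a + b) / 2| := Real.abs_sin_le_abs
  have h2 : |Real.sin ((a - b) / 2)| ≤ |(a - b) / 2| := Real.abs_sin_le_abs
  have e1 : |(a + b) / 2| = |a + b| / 2 := by rw [abs_div, abs_two]
  have e2 : |(a - b) / 2| = |a - b| / 2 := by rw [abs_div, abs_two]
  rw [e1] at h1
  rw [e2] at h2
  have h3 : |Real.sin ((a + b) / 2)| * |Real.sin ((a - b) / 2)| ≤ (|a + b| / 2) * (|a - b| / 2) :=
    mul_le_mul h1 h2 (abs_nonneg _) (by positivity)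
  calc |-2 * Real.sin ((a + b) / 2) * Real.sin ((a - b) / 2)|
      = 2 * (|Real.sin ((a + b) / 2)| * |Real.sin ((a - b) / 2)|) := by
        rw [abs_mul, abs_mul, abs_neg, abs_two]; ring
    _ ≤ 2 * ((|a + b| / 2) * (|a - b| / 2)) := by linarith
    _ = |a + b| * |a - b| / 2 := by ring

/-- The real-arithmetic heart of the composition: floor bound at `θ̄` + comparison bound + cosine Lipschitz ⟹ the rung's
bound with constant `4·max C₁ 0 + max C₂ 0 + 2`. -/
theorem combine (θ δ θb e t C₁ C₂ X₁ X₂ X dU dUc d1 : ℝ) (ht : 1 ≤ t) (hδ : 0 ≤ δ)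
    (hθb : |θb - θ| ≤ δ) (he : |e| ≤ δ) (hX : 0 ≤ X) (hX₁ : 0 ≤ X₁) (hX₂ : 0 ≤ X₂) (hX₁X : X₁ ≤ X) (hX₂X : X₂ ≤ X)
    (hA : |dU - dUc| ≤ C₂ * (|θ| + δ) * δ * t + C₂ * (θ ^ 2 + δ ^ 2) ^ 2 * t ^ 2 + C₂ * X₂ / t ^ 2)
    (hF : |dUc - d1 - (1 - Real.cos θb) / (3 * Real.pi ^ 2)| ≤ C₁ * θb ^ 2 * (1 / t + θb ^ 2 * t ^ 2) + C₁ * X₁ / t ^ 2) :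
    |dU - d1 - (1 - Real.cos (θ + e)) / (3 * Real.pi ^ 2)| ≤
      (4 * max C₁ 0 + max C₂ 0 + 2) * (θ ^ 2 + δ ^ 2) * (1 / t + (θ ^ 2 + δ ^ 2) * t ^ 2) +
        (4 * max C₁ 0 + max C₂ 0 + 2) * (|θ| + δ) * δ * t + (4 * max C₁ 0 + max C₂ 0 + 2) * X / t ^ 2 := by
  -- atoms
  set S := |θ| + δ with hS
  set P := θ ^ 2 + δ ^ 2 with hP
  set K₁ := max C₁ 0 with hK₁
  set K₂ := max C₂ 0 with hK₂
  have ht0 : 0 < t := lt_of_lt_of_le one_pos ht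
  have ht2 : 0 < t ^ 2 := by positivity
  have hu : 0 < 1 / t := by positivity
  have hS0 : 0 ≤ S := by positivity
  have hP0 : 0 ≤ P := by positivity
  have hK₁0 : 0 ≤ K₁ := le_max_right _ _
  have hK₂0 : 0 ≤ K₂ := le_max_right _ _
  have hC₁K : C₁ ≤ K₁ := le_max_left _ _
  have hC₂K : C₂ ≤ K₂ := le_max_left _ _
  -- |θb| ≤ S, θb² ≤ 2P, θb⁴ ≤ 4P²
  have f1 : |θb| ≤ S := by
    have := abs_sub_abs_le_abs_sub θb θ
    rw [hS]; linarith
  have f3 : S ^ 2 ≤ 2 * P := by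
    rw [hS, hP]; nlinarith [sq_abs θ, sq_nonneg (|θ| - δ), abs_nonneg θ]
  have f4 : θb ^ 2 ≤ 2 * P := by
    have h : |θb| ^ 2 ≤ S ^ 2 := pow_le_pow_left₀ (abs_nonneg θb) f1 2
    rw [sq_abs] at h
    linarith
  have f5 : θb ^ 4 ≤ 4 * P ^ 2 := by
    have h : (θb ^ 2) ^ 2 ≤ (2 * P) ^ 2 := pow_le_pow_left₀ (sq_nonneg θb) f4 2
    calc θb ^ 4 = (θb ^ 2) ^ 2 := by ring
      _ ≤ (2 * P) ^ 2 := h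
      _ = 4 * P ^ 2 := by ring
  -- upgrade the constants to nonnegative ones
  have hQb : 0 ≤ θb ^ 2 * (1 / t + θb ^ 2 * t ^ 2) := by positivity
  have hF' : |dUc - d1 - (1 - Real.cos θb) / (3 * Real.pi ^ 2)| ≤
      K₁ * (θb ^ 2 * (1 / t + θb ^ 2 * t ^ 2)) + K₁ * X₁ / t ^ 2 := by
    have h1 : C₁ * θb ^ 2 * (1 / t + θb ^ 2 * t ^ 2) ≤ K₁ * (θb ^ 2 * (1 / t + θb ^ 2 * t ^ 2)) := by
      rw [mul_assoc]; exact mul_le_mul_of_nonneg_right hC₁K hQb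
    have h2 : C₁ * X₁ / t ^ 2 ≤ K₁ * X₁ / t ^ 2 :=
      div_le_div_of_nonneg_right (mul_le_mul_of_nonneg_right hC₁K hX₁) ht2.le
    linarith
  have hRa : 0 ≤ (|θ| + δ) * δ * t := by positivity
  have hRb : 0 ≤ (θ ^ 2 + δ ^ 2) ^ 2 * t ^ 2 := by positivity
  have hA' : |dU - dUc| ≤ K₂ * ((|θ| + δ) * δ * t) + K₂ * ((θ ^ 2 + δ ^ 2) ^ 2 * t ^ 2) + K₂ * X₂ / t ^ 2 := by
    have h1 : C₂ * (|θ| + δ) * δ * t ≤ K₂ * ((|θ| + δ) * δ * t) := by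
      have : C₂ * (|θ| + δ) * δ * t = C₂ * ((|θ| + δ) * δ * t) := by ring
      rw [this]; exact mul_le_mul_of_nonneg_right hC₂K hRa
    have h2 : C₂ * (θ ^ 2 + δ ^ 2) ^ 2 * t ^ 2 ≤ K₂ * ((θ ^ 2 + δ ^ 2) ^ 2 * t ^ 2) := by
      rw [mul_assoc]; exact mul_le_mul_of_nonneg_right hC₂K hRb
    have h3 : C₂ * X₂ / t ^ 2 ≤ K₂ * X₂ / t ^ 2 :=
      div_le_div_of_nonneg_right (mul_le_mul_of_nonneg_right hC₂K hX₂) ht2.le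
    linarith
  -- the cosine term
  have hcos : |(1 - Real.cos θb) / (3 * Real.pi ^ 2) - (1 - Real.cos (θ + e)) / (3 * Real.pi ^ 2)| ≤ 2 * S * δ := by
    have hπ : 1 ≤ 3 * Real.pi ^ 2 := by nlinarith [Real.pi_gt_three]
    have e0 : (1 - Real.cos θb) / (3 * Real.pi ^ 2) - (1 - Real.cos (θ + e)) / (3 * Real.pi ^ 2) =
        (Real.cos (θ + e) - Real.cos θb) / (3 * Real.pi ^ 2) := by ring
    rw [e0, abs_div, abs_of_pos (by positivity : (0:ℝ) < 3 * Real.pi ^ 2)]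
    have h1 : |Real.cos (θ + e) - Real.cos θb| ≤ |θ + e + θb| * |θ + e - θb| / 2 := abs_cos_sub_cos_le_mul _ _
    have h2 : |θ + e + θb| ≤ 2 * S := by
      have := abs_add_le (θ + e) θb
      have := abs_add_le θ e
      rw [hS]; linarith
    have h3 : |θ + e - θb| ≤ 2 * δ := by
      have : |θ + e - θb| = |e + (θ - θb)| := by ring_nf
      rw [this]
      have := abs_add_le e (θ - θb)
      rw [abs_sub_comm θ θb] at this
      linarith
    have h4 : |θ + e + θb| * |θ + e - θb| ≤ (2 * S) * (2 * δ) :=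
      mul_le_mul h2 h3 (abs_nonneg _) (by positivity)
    calc |Real.cos (θ + e) - Real.cos θb| / (3 * Real.pi ^ 2)
        ≤ |Real.cos (θ + e) - Real.cos θb| := div_le_self (abs_nonneg _) hπ
      _ ≤ |θ + e + θb| * |θ + e - θb| / 2 := h1
      _ ≤ (2 * S) * (2 * δ) / 2 := div_le_div_of_nonneg_right h4 (by norm_num)
      _ = 2 * S * δ := by ring
  -- triangle inequality
  have htri : |dU - d1 - (1 - Real.cos (θ + e)) / (3 * Real.pi ^ 2)| ≤
      |dU - dUc| + |dUc - d1 - (1 - Real.cos θb) / (3 * Real.pi ^ 2)| +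
        |(1 - Real.cos θb) / (3 * Real.pi ^ 2) - (1 - Real.cos (θ + e)) / (3 * Real.pi ^ 2)| := by
    have e0 : dU - d1 - (1 - Real.cos (θ + e)) / (3 * Real.pi ^ 2) =
        (dU - dUc) + (dUc - d1 - (1 - Real.cos θb) / (3 * Real.pi ^ 2)) +
          ((1 - Real.cos θb) / (3 * Real.pi ^ 2) - (1 - Real.cos (θ + e)) / (3 * Real.pi ^ 2)) := by ring
    rw [e0]
    exact abs_add_three _ _ _
  -- bounding the pieces by the rung's three terms
  have hPt : 0 ≤ P / t := by positivity
  have p3 : θb ^ 2 * (1 / t + θb ^ 2 * t ^ 2) ≤ 4 * (P * (1 / t + P * t ^ 2)) := by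
    have h1 : θb ^ 2 * (1 / t) ≤ 2 * P * (1 / t) := mul_le_mul_of_nonneg_right f4 hu.le
    have h2 : θb ^ 2 * (θb ^ 2 * t ^ 2) ≤ 4 * P ^ 2 * t ^ 2 := by
      calc θb ^ 2 * (θb ^ 2 * t ^ 2) = θb ^ 4 * t ^ 2 := by ring
        _ ≤ 4 * P ^ 2 * t ^ 2 := mul_le_mul_of_nonneg_right f5 ht2.le
    have h3 : 0 ≤ P * (1 / t) := by positivity
    have e1 : θb ^ 2 * (1 / t + θb ^ 2 * t ^ 2) = θb ^ 2 * (1 / t) + θb ^ 2 * (θb ^ 2 * t ^ 2) := by ring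
    have e2 : 4 * (P * (1 / t + P * t ^ 2)) = 4 * (P * (1 / t)) + 4 * P ^ 2 * t ^ 2 := by ring
    rw [e1, e2]
    have e3 : 2 * P * (1 / t) = 2 * (P * (1 / t)) := by ring
    rw [e3] at h1
    linarith
  have p2 : (θ ^ 2 + δ ^ 2) ^ 2 * t ^ 2 ≤ P * (1 / t + P * t ^ 2) := by
    rw [← hP]
    have h3 : 0 ≤ P * (1 / t) := by positivity
    have e2 : P * (1 / t + P * t ^ 2) = P * (1 / t) + P ^ 2 * t ^ 2 := by ring
    rw [e2]
    linarith
  have p5 : 2 * S * δ ≤ 2 * (S * δ * t) := by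
    have : S * δ * 1 ≤ S * δ * t := mul_le_mul_of_nonneg_left ht (by positivity)
    linarith
  have p4 : K₁ * X₁ / t ^ 2 + K₂ * X₂ / t ^ 2 ≤ (K₁ + K₂) * X / t ^ 2 := by
    rw [← add_div]
    apply div_le_div_of_nonneg_right _ ht2.le
    have h1 := mul_le_mul_of_nonneg_left hX₁X hK₁0
    have h2 := mul_le_mul_of_nonneg_left hX₂X hK₂0
    have e1 : (K₁ + K₂) * X = K₁ * X + K₂ * X := by ring
    rw [e1]
    linarith
  -- assemble
  have hQ0 : 0 ≤ P * (1 / t + P * t ^ 2) := by positivity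
  have hR0 : 0 ≤ S * δ * t := by positivity
  have hW0 : 0 ≤ X / t ^ 2 := by positivity
  have eQ : (4 * K₁ + K₂ + 2) * (θ ^ 2 + δ ^ 2) * (1 / t + (θ ^ 2 + δ ^ 2) * t ^ 2) =
      (4 * K₁ + K₂ + 2) * (P * (1 / t + P * t ^ 2)) := by rw [hP]; ring
  have eR : (4 * K₁ + K₂ + 2) * (|θ| + δ) * δ * t = (4 * K₁ + K₂ + 2) * (S * δ * t) := by rw [hS]; ring
  have eW : (4 * K₁ + K₂ + 2) * X / t ^ 2 = (4 * K₁ + K₂ + 2) * (X / t ^ 2) := by ring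
  have eW' : (K₁ + K₂) * X / t ^ 2 = (K₁ + K₂) * (X / t ^ 2) := by ring
  have eA : K₂ * ((|θ| + δ) * δ * t) = K₂ * (S * δ * t) := by rw [hS]
  rw [eQ, eR, eW]
  rw [eW'] at p4
  rw [eA] at hA'
  have s1 : K₁ * (θb ^ 2 * (1 / t + θb ^ 2 * t ^ 2)) ≤ 4 * K₁ * (P * (1 / t + P * t ^ 2)) := by
    have h := mul_le_mul_of_nonneg_left p3 hK₁0
    have e1 : K₁ * (4 * (P * (1 / t + P * t ^ 2))) = 4 * K₁ * (P * (1 / t + P * t ^ 2)) := by ring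
    rw [e1] at h
    exact h
  have s2 : K₂ * ((θ ^ 2 + δ ^ 2) ^ 2 * t ^ 2) ≤ K₂ * (P * (1 / t + P * t ^ 2)) := mul_le_mul_of_nonneg_left p2 hK₂0
  -- everything is now linear in the monomials; name them
  set Q := P * (1 / t + P * t ^ 2) with hQ
  set R := S * δ * t with hR
  set W := X / t ^ 2 with hW
  have z1 : 0 ≤ K₁ * R := mul_nonneg hK₁0 hR0
  have z2 : 0 ≤ K₁ * W := mul_nonneg hK₁0 hW0
  have z3 : 0 ≤ K₂ * W := mul_nonneg hK₂0 hW0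
  have z4 : 0 ≤ K₁ * Q := mul_nonneg hK₁0 hQ0
  have eK1 : (4 * K₁ + K₂ + 2) * Q = 4 * (K₁ * Q) + K₂ * Q + 2 * Q := by ring
  have eK2 : (4 * K₁ + K₂ + 2) * R = 4 * (K₁ * R) + K₂ * R + 2 * R := by ring
  have eK3 : (4 * K₁ + K₂ + 2) * W = 4 * (K₁ * W) + K₂ * W + 2 * W := by ring
  have eK4 : (K₁ + K₂) * W = K₁ * W + K₂ * W := by ring
  have eK5 : 4 * K₁ * Q = 4 * (K₁ * Q) := by ring
  rw [eK1, eK2, eK3]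
  rw [eK4] at p4
  rw [eK5] at s1
  linarith [htri, hA', hF', hcos, p4, p5, s1, s2, hQ0, hR0, hW0]

/-- **Composition** (`<Rung>_of`, BC3 shape): the two stub STATEMENTS imply the rung, the proved floor
`QuarkLoopCoefficient_of` being invoked BY NAME at the quantised comparison flux. -/
theorem QuarkLoopNearConstantFlux_of : ComparisonFlux → FrozenComparison → QuarkLoopNearConstantFlux 1 := by
  intro hcmp hfrz
  obtain ⟨C₁, c₁, hc₁, F⟩ := Summit.QuantumFields.QCD.Cruxes.QuarkLoopCoefficient.Sketch.QuarkLoopCoefficient_of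
  obtain ⟨C₂, c₂, hc₂, A⟩ := hfrz
  refine ⟨4 * max C₁ 0 + max C₂ 0 + 2, min c₁ c₂, lt_min hc₁ hc₂, ?_⟩
  intro δ hδ0 _hδ1 L _ U θ η hη h1 h2 h3 t ht htL htθ x
  obtain ⟨Uc, θb, hc1, hc2, hc3, hθb⟩ := hcmp L U θ δ η hδ0 hη h1 h2 h3
  have ht0 : 0 ≤ t := le_trans zero_le_one ht
  have hθbS : |θb| ≤ |θ| + δ := by
    have := abs_sub_abs_le_abs_sub θb θ
    linarith
  have htθb : t * |θb| ≤ 1 := le_trans (mul_le_mul_of_nonneg_left hθbS ht0) htθ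
  have hF := F L Uc θb hc1 hc2 hc3 t ht htL htθb x
  have hA := A L U Uc θ θb δ η hδ0 hη hθb h1 h2 h3 hc1 hc2 hc3 t ht htL htθ x
  have hLt : 0 ≤ (L : ℝ) ^ 2 / (t + (L : ℝ)) := by positivity
  have hX₁X : Real.exp (-(c₁ * (L : ℝ) ^ 2 / (t + (L : ℝ)))) ≤ Real.exp (-(min c₁ c₂ * (L : ℝ) ^ 2 / (t + (L : ℝ)))) := by
    apply Real.exp_le_exp.mpr
    have : min c₁ c₂ * (L : ℝ) ^ 2 / (t + (L : ℝ)) ≤ c₁ * (L : ℝ) ^ 2 / (t + (L : ℝ)) := by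
      rw [mul_div_assoc, mul_div_assoc]
      exact mul_le_mul_of_nonneg_right (min_le_left _ _) hLt
    linarith
  have hX₂X : Real.exp (-(c₂ * (L : ℝ) ^ 2 / (t + (L : ℝ)))) ≤ Real.exp (-(min c₁ c₂ * (L : ℝ) ^ 2 / (t + (L : ℝ)))) := by
    apply Real.exp_le_exp.mpr
    have : min c₁ c₂ * (L : ℝ) ^ 2 / (t + (L : ℝ)) ≤ c₂ * (L : ℝ) ^ 2 / (t + (L : ℝ)) := by
      rw [mul_div_assoc, mul_div_assoc]
      exact mul_le_mul_of_nonneg_right (min_le_right _ _) hLt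
    linarith
  exact combine θ δ θb (η x) t C₁ C₂ _ _ _ _ _ _ ht hδ0 hθb (hη x) (Real.exp_pos _).le (Real.exp_pos _).le
    (Real.exp_pos _).le hX₁X hX₂X hA hF

/-- The rung from the registered stubs (sorries ONLY inside `stub_comparisonFlux`, `stub_frozenComparison`). -/
theorem quarkLoopNearConstantFlux_from_stubs : QuarkLoopNearConstantFlux 1 :=
  QuarkLoopNearConstantFlux_of stub_comparisonFlux stub_frozenComparison

/-- Monotonicity of the family (larger `δ₀` = stronger statement); with the witness this places the floor at `0`. -/
theorem quarkLoopNearConstantFlux_mono {a b : ℝ} (hab : a ≤ b) (h : QuarkLoopNearConstantFlux b) :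
    QuarkLoopNearConstantFlux a := by
  obtain ⟨C, c, hc, H⟩ := h
  exact ⟨C, c, hc, fun δ hδ0 hδa => H δ hδ0 (le_trans hδa hab)⟩

/-! ## §5 The rung by name, and the floor witness (F3 / BC5, sorry-free) -/

/-- **Rung** (forward generator G1, seed `g1-QuantumFields-16786`): member `δ₀ = 1` of the family — the floor
`QuarkLoopCoefficient` with its ONE constant-flux hypothesis generalised to near-constant flux `θ + η y`, `|η y| ≤ δ`. -/
def Rung : Prop := QuarkLoopNearConstantFlux 1

/-- Composition concluding the rung BY NAME (kernel-checked; sorries only inside the two registered stubs). -/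
theorem Rung_of : ComparisonFlux → FrozenComparison → Rung :=
  fun h1 h2 => QuarkLoopNearConstantFlux_of h1 h2

/-- The rung from the registered stubs. -/
theorem rung_from_stubs : Rung := Rung_of stub_comparisonFlux stub_frozenComparison

/-- **Floor witness (F3 / BC5)**: member `0` of the family IS the proved floor — it follows from the seed theorem
`QuarkLoopCoefficient_of` BY NAME (no stub, no sorry).  Published again as `Lines/NearConstantFlux_special.lean`. -/
theorem floor_specialises : QuarkLoopNearConstantFlux 0 := by
  obtain ⟨C, c, hc, H⟩ := Summit.QuantumFields.QCD.Cruxes.QuarkLoopCoefficient.Sketch.QuarkLoopCoefficient_of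
  refine ⟨C, c, hc, ?_⟩
  intro δ hδ0 hδ1 L _ U θ η hη h1 h2 h3 t ht htL htθ x
  obtain rfl : δ = 0 := le_antisymm hδ1 hδ0
  have hη0 : ∀ y, η y = 0 := fun y => abs_nonpos_iff.mp (hη y)
  simp only [hη0, Complex.ofReal_zero, add_zero] at h2 htθ
  simp only [hη0, add_zero, ne_eq, OfNat.ofNat_ne_zero, not_false_eq_true, zero_pow, mul_zero, zero_mul]
  exact H L U θ h1 h2 h3 t ht htL htθ x

end Summit.QuantumFields.QCD.Cruxes.InterleavedFlowProper.NearConstantFlux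

end
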